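import Summits.Ventures.PercRepro.SixThreeStep5D

/-!
# PercRepro — Step 5 of Lemma PL (`g ≥ 41`), continuation `SixThreeStep5` (p3 gen 8; split of the gen-7 module
`SixThreeStep5.lean` into five parts per the 400-line lint, proofs byte-identical, preambles only)

Parts VII–VIII of the original module: the sum over the short lines (`sum_B_short_ge`), the five rows for `g ≥ 41`
(`table_*_large`) and the rows for every `g ≥ 4` (`table_*_all`, the table rows of record for the seam).
-/

namespace PercRepro.SixThree.Table

/-! ## Part VII: the sum over the short lines -/

/-- `2^m·h ≤ 2^h·C(m,2)` for `3 ≤ m ≤ h`. -/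
theorem two_pow_mul_le_aux {m : ℕ} (hm : 3 ≤ m) : ∀ h, m ≤ h → 2 ^ m * h ≤ 2 ^ h * m.choose 2 := by
  intro h hh
  induction h, hh using Nat.le_induction with
  | base =>
    have : m ≤ m.choose 2 := by
      rw [Nat.choose_two_right]
      have : m * 2 ≤ m * (m - 1) := Nat.mul_le_mul_left m (by omega)
      omega
    exact Nat.mul_le_mul_left _ this
  | succ n hn ih =>
    have h2 : 2 ^ m ≤ 2 ^ n * m.choose 2 := by
      have h1' : 1 ≤ m.choose 2 := Nat.succ_le_of_lt (Nat.choose_pos (by omega))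
      have h2' : 2 ^ m ≤ 2 ^ n := Nat.pow_le_pow_right (by norm_num) hn
      calc 2 ^ m ≤ 2 ^ n := h2'
        _ = 2 ^ n * 1 := (mul_one _).symm
        _ ≤ 2 ^ n * m.choose 2 := Nat.mul_le_mul_left _ h1'
    rw [show (2 : ℕ) ^ (n + 1) = 2 ^ n * 2 by ring]
    nlinarith

/-- `2^m·C(h,2) ≤ 2^h·C(m,2)` for `3 ≤ m ≤ h` (`2^m / C(m,2)` is increasing). -/
theorem two_pow_mul_choose_le {m : ℕ} (hm : 3 ≤ m) : ∀ h, m ≤ h → 2 ^ m * h.choose 2 ≤ 2 ^ h * m.choose 2 := by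
  intro h hh
  induction h, hh using Nat.le_induction with
  | base => exact le_rfl
  | succ n hn ih =>
    have e : (n + 1).choose 2 = n + n.choose 2 := by
      have := Nat.choose_succ_succ' n 1
      simpa [Nat.choose_one_right] using this
    have h1 := two_pow_mul_le_aux hm n hn
    rw [e, pow_succ]
    nlinarith

/-- Over a list of short lines (`3 ≤ m ≤ h`): `C(h,2)·Σ 2^m ≤ 2^h·Σ C(m,2)`. -/
theorem sum_two_pow_le {h : ℕ} (prof : List ℕ) (hshort : ∀ m ∈ prof, 3 ≤ m ∧ m ≤ h) :
    ((h.choose 2 : ℕ) : ℚ) * (prof.map fun m => (2 : ℚ) ^ m).sum ≤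
      (2 : ℚ) ^ h * (prof.map fun m => ((m.choose 2 : ℕ) : ℚ)).sum := by
  induction prof with
  | nil => simp
  | cons m l ih =>
    have hm := hshort m List.mem_cons_self
    have hl := ih fun x hx => hshort x (List.mem_cons_of_mem _ hx)
    have h1 : (2 : ℚ) ^ m * ((h.choose 2 : ℕ) : ℚ) ≤ 2 ^ h * ((m.choose 2 : ℕ) : ℚ) := by
      exact_mod_cast two_pow_mul_choose_le hm.1 h hm.2
    simp only [List.map_cons, List.sum_cons, mul_add]
    linarith

/-- `Σ_{m ∈ prof} B_t(g, m) ≥ −K(g)·Σ 2^m` with `K(g) = 15·(3 + 2g + C(g,2))`, for short lines. -/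
theorem sum_B_ge_sum_two_pow {t g : ℕ} (ht : t = 1 ∨ t = 2 ∨ t = 3) (hg : 5 ≤ g) (prof : List ℕ)
    (hprof : ∀ m ∈ prof, 3 ≤ m ∧ m ≤ g) :
    -(15 * (3 + 2 * (g : ℚ) + ((g.choose 2 : ℕ) : ℚ)) * (prof.map fun m => (2 : ℚ) ^ m).sum) ≤
      (prof.map (B t g)).sum := by
  induction prof with
  | nil => simp
  | cons m l ih =>
    have hm := hprof m List.mem_cons_self
    have hl := ih fun x hx => hprof x (List.mem_cons_of_mem _ hx)
    have h1 := B_ge ht hm.1 hm.2 hg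
    simp only [List.map_cons, List.sum_cons, mul_add]
    linarith

/-- `10·C(g,2) ≤ 41·C(⌊(g+1)/2⌋, 2)` for `g ≥ 41`. -/
theorem ten_choose_le {g : ℕ} (hg : 41 ≤ g) : 10 * (g.choose 2 : ℚ) ≤ 41 * (((g + 1) / 2).choose 2 : ℕ) := by
  rw [Nat.cast_choose_two, Nat.cast_choose_two]
  set h := (g + 1) / 2 with hh
  have h21 : 21 ≤ h := by omega
  have hc : (21 : ℚ) ≤ h := by exact_mod_cast h21
  rcases Nat.even_or_odd g with ⟨k, hk⟩ | ⟨k, hk⟩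
  · have e : g = 2 * h := by omega
    have e' : (g : ℚ) = 2 * h := by exact_mod_cast e
    rw [e']
    nlinarith
  · have e : g = 2 * h - 1 := by omega
    have e' : (g : ℚ) = 2 * h - 1 := by
      have : g + 1 = 2 * h := by omega
      have : ((g + 1 : ℕ) : ℚ) = ((2 * h : ℕ) : ℚ) := by rw [this]
      push_cast at this; linarith
    rw [e']
    nlinarith

/-- `6150·(2k² + 5k + 5) ≤ 6·2^k` for `k ≥ 20`. -/
theorem short_exp {k : ℕ} (hk : 20 ≤ k) : 6150 * (2 * k ^ 2 + 5 * k + 5) ≤ 6 * 2 ^ k := by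
  induction k, hk using Nat.le_induction with
  | base => norm_num
  | succ n hn ih =>
    rw [show (2 : ℕ) ^ (n + 1) = 2 * 2 ^ n by ring]
    nlinarith

/-- **The short-sum bound**: for `g ≥ 41` and short lines (`3 ≤ m ≤ ⌊(g+1)/2⌋`) with `Σ C(m,2) ≤ C(g,2)`,
`Σ_{m ∈ prof} B_t(g, m) ≥ −(6/100)·2^g`. -/
theorem sum_B_short_ge {t g : ℕ} (ht : t = 1 ∨ t = 2 ∨ t = 3) (hg : 41 ≤ g) (prof : List ℕ)
    (hshort : ∀ m ∈ prof, 3 ≤ m ∧ m ≤ (g + 1) / 2)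
    (hsum : (prof.map fun m => ((m.choose 2 : ℕ) : ℚ)).sum ≤ ((g.choose 2 : ℕ) : ℚ)) :
    -(6 / 100 * (2 : ℚ) ^ g) ≤ (prof.map (B t g)).sum := by
  have h3 := ten_choose_le hg
  generalize hh : (g + 1) / 2 = h at hshort h3
  obtain ⟨k, rfl⟩ : ∃ k, g = h + k := ⟨g - h, by omega⟩
  have hk20 : 20 ≤ k := by omega
  have hgk : h + k ≤ 2 * k + 1 := by omega
  have h1 := sum_B_ge_sum_two_pow (g := h + k) ht (by omega) prof
    (fun m hm => ⟨(hshort m hm).1, by have := (hshort m hm).2; omega⟩)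
  have h2 := sum_two_pow_le prof hshort
  have h4 : ((6150 : ℕ) * (2 * k ^ 2 + 5 * k + 5) : ℚ) ≤ 6 * 2 ^ k := by exact_mod_cast short_exp hk20
  -- `K(g) ≤ 15 (2k² + 5k + 5)`
  have hK : 15 * (3 + 2 * ((h + k : ℕ) : ℚ) + (((h + k).choose 2 : ℕ) : ℚ)) ≤ 15 * (2 * (k : ℚ) ^ 2 + 5 * k + 5) := by
    have hc : (((h + k).choose 2 : ℕ) : ℚ) ≤ (((2 * k + 1).choose 2 : ℕ) : ℚ) := by
      exact_mod_cast Nat.choose_le_choose 2 hgk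
    have e : (((2 * k + 1).choose 2 : ℕ) : ℚ) = k * (2 * k + 1) := by
      rw [Nat.cast_choose_two]; push_cast; ring
    have hg' : ((h + k : ℕ) : ℚ) ≤ 2 * k + 1 := by exact_mod_cast hgk
    rw [e] at hc
    nlinarith
  have hC : (0 : ℚ) < ((h.choose 2 : ℕ) : ℚ) := by
    have : 1 ≤ h.choose 2 := Nat.succ_le_of_lt (Nat.choose_pos (by omega))
    exact_mod_cast this
  have hS0 : 0 ≤ (prof.map fun m => (2 : ℚ) ^ m).sum := by
    apply List.sum_nonneg; intro x hx
    rw [List.mem_map] at hx; obtain ⟨m, -, rfl⟩ := hx; positivity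
  have hp : (0 : ℚ) ≤ 2 ^ h := by positivity
  -- `Σ 2^m · C(h,2) · 10 ≤ 2^h · 41 · C(h,2)`
  have h5 := mul_le_mul_of_nonneg_left hsum hp
  have h6 := mul_le_mul_of_nonneg_left h3 hp
  have hS : (prof.map fun m => (2 : ℚ) ^ m).sum * 10 * ((h.choose 2 : ℕ) : ℚ) ≤ 2 ^ h * 41 * ((h.choose 2 : ℕ) : ℚ) := by
    nlinarith
  have hS' : (prof.map fun m => (2 : ℚ) ^ m).sum * 10 ≤ 2 ^ h * 41 := le_of_mul_le_mul_right hS hC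
  -- assemble
  have e2 : (2 : ℚ) ^ (h + k) = 2 ^ h * 2 ^ k := pow_add _ _ _
  have hKS : 15 * (3 + 2 * ((h + k : ℕ) : ℚ) + (((h + k).choose 2 : ℕ) : ℚ)) * (prof.map fun m => (2 : ℚ) ^ m).sum ≤
      15 * (2 * (k : ℚ) ^ 2 + 5 * k + 5) * (2 ^ h * 41 / 10) := by
    apply mul_le_mul hK (by linarith) hS0 (by positivity)
  have hfin : 15 * (2 * (k : ℚ) ^ 2 + 5 * k + 5) * (2 ^ h * 41 / 10) ≤ 6 / 100 * (2 ^ h * 2 ^ k) := by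
    push_cast at h4
    nlinarith
  rw [e2]
  linarith


/-! ## Part VIII: the five rows for `g ≥ 41`, and the rows for every `g ≥ 4` -/

/-- `15·S₅(g) ≤ (3/100)·2^g` for `g ≥ 41`. -/
theorem S5_small {g : ℕ} (hg : 41 ≤ g) : 15 * S5 g ≤ 3 / 100 * 2 ^ g := by
  have hx : (41 : ℚ) ≤ g := by exact_mod_cast hg
  obtain ⟨c1, c2, c3, c4⟩ := pow_chain hx
  have hP := poly_le_two_pow hg
  have h := S5_le g
  have h0 : (1 : ℚ) ≤ g := by linarith
  nlinarith

/-- `2^g ≥ 2^41` for `g ≥ 41`. -/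
theorem two_pow_ge {g : ℕ} (hg : 41 ≤ g) : (2 : ℚ) ^ 41 ≤ 2 ^ g := pow_le_pow_right₀ (by norm_num) hg

/-- `A_t(g) + B_t(g, m) = Δ_t(g, [m])`. -/
theorem A_add_B (t g m : ℕ) : A t g + B t g m = Δ t g [m] := by unfold B; ring

/-- **One long line, `g ≥ 41`**: `Δ_t(g, [m]) ≥ (1/2 − 1/100)·2^g` for `3 ≤ m`, `m + 2 ≤ g`. -/
theorem Δ_single_large {t g m : ℕ} (ht : t = 1 ∨ t = 2 ∨ t = 3) (hg : 41 ≤ g) (hm3 : 3 ≤ m) (hmg : m + 2 ≤ g) :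
    (1 / 2 - 1 / 100) * (2 : ℚ) ^ g ≤ Δ t g [m] := by
  have h1 := Δ_single_ge (g := g) ht hm3 (by omega) (by omega)
  have h2 := cNum_ge ht (j := g - m) (by omega)
  have h3 := loss_le ht hg (by omega : m ≤ g)
  have e : (2 : ℚ) ^ g = 2 ^ m * 2 ^ (g - m) := by rw [← pow_add, Nat.add_sub_cancel' (by omega : m ≤ g)]
  have hp : (0 : ℚ) ≤ 2 ^ m := by positivity
  have h4 := mul_le_mul_of_nonneg_left h2 hp
  rw [e]
  linarith

/-- **General plane, no long line, `g ≥ 41`**. -/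
theorem table_general_short_large {t g : ℕ} (ht : t = 1 ∨ t = 2 ∨ t = 3) (hg41 : 41 ≤ g)
    (prof : List ℕ) (hshort : ∀ m ∈ prof, 3 ≤ m ∧ m ≤ (g + 1) / 2)
    (hsum : (prof.map fun m => (ch m 2 : ℚ)).sum ≤ ch g 2) :
    0 ≤ A t g + (prof.map (B t g)).sum := by
  simp only [ch_eq_choose] at hsum
  have hA := A_ge ht (by omega : 5 ≤ g)
  have hS := S5_small hg41
  have hB := sum_B_short_ge ht hg41 prof hshort hsum
  have hr := r6_ge ht
  have hr' := r6_le ht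
  have hp : (0 : ℚ) ≤ 2 ^ g := by positivity
  have hS0 := S5_nonneg g
  have h1 : (49 / 10 : ℚ) * 2 ^ g ≤ r6 t * 2 ^ g := mul_le_mul_of_nonneg_right hr hp
  have h2 : r6 t * S5 g ≤ 15 * S5 g := mul_le_mul_of_nonneg_right hr' hS0
  nlinarith

/-- **General plane with one long line, `g ≥ 41`**. -/
theorem table_general_long_large {t g : ℕ} (ht : t = 1 ∨ t = 2 ∨ t = 3) (hg41 : 41 ≤ g)
    (m₀ : ℕ) (hm₀ : (g + 1) / 2 < m₀) (hm₀' : m₀ + 3 ≤ g)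
    (prof : List ℕ) (hshort : ∀ m ∈ prof, 3 ≤ m ∧ m ≤ (g + 1) / 2)
    (hsum : (ch m₀ 2 : ℚ) + (prof.map fun m => (ch m 2 : ℚ)).sum ≤ ch g 2) :
    0 ≤ A t g + B t g m₀ + (prof.map (B t g)).sum := by
  simp only [ch_eq_choose] at hsum
  have hsum' : (prof.map fun m => ((m.choose 2 : ℕ) : ℚ)).sum ≤ ((g.choose 2 : ℕ) : ℚ) := by
    have : (0 : ℚ) ≤ ((m₀.choose 2 : ℕ) : ℚ) := by positivity
    linarith
  have hΔ := Δ_single_large ht hg41 (m := m₀) (by omega) (by omega)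
  have hB := sum_B_short_ge ht hg41 prof hshort hsum'
  have hp : (0 : ℚ) ≤ 2 ^ g := by positivity
  rw [A_add_B]
  linarith

/-- **Line + point, `g ≥ 41`**: `0 ≤ A_t(g) + B_t(g, g − 1) − 3·[t = 2]`. -/
theorem table_linePoint_large {t g : ℕ} (ht : t = 1 ∨ t = 2 ∨ t = 3) (hg41 : 41 ≤ g) :
    0 ≤ A t g + B t g (g - 1) - (if t = 2 then 3 else 0) := by
  rw [A_add_B]
  have h1 := Δ_single_ge (g := g) (m := g - 1) ht (by omega) (by omega) (by omega)
  rw [show g - (g - 1) = 1 by omega] at h1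
  have h2 := cNum_one_ge ht
  have h3 := loss_le ht hg41 (Nat.sub_le g 1)
  have e : (2 : ℚ) ^ g = 2 * 2 ^ (g - 1) := by
    rw [← pow_succ', Nat.sub_add_cancel (by omega : 1 ≤ g)]
  have hp : (0 : ℚ) ≤ 2 ^ (g - 1) := by positivity
  have h4 := mul_le_mul_of_nonneg_left h2 hp
  have h5 := two_pow_ge hg41
  have hi : (if t = 2 then (3 : ℚ) else 0) ≤ 3 := by split_ifs <;> norm_num
  rw [e] at h3 h5
  nlinarith

/-- **Two lines meeting in a point, `g ≥ 41`**. -/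
theorem table_twoLines_meet_large {t g : ℕ} (ht : t = 1 ∨ t = 2 ∨ t = 3) (hg41 : 41 ≤ g)
    {m₁ m₂ : ℕ} (h3 : 3 ≤ m₂) (hle : m₂ ≤ m₁) (hsum : m₁ + m₂ = g + 1) :
    0 ≤ A t g + B t g m₁ + B t g m₂ - (if t = 3 then 12 else 0) := by
  rw [A_add_B]
  have hΔ := Δ_single_large ht hg41 (m := m₁) (by omega) (by omega)
  have hB := sum_B_short_ge ht hg41 [m₂] (by
      intro m hm; simp only [List.mem_singleton] at hm; subst hm; exact ⟨h3, by omega⟩)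
    (by
      simp only [List.map_cons, List.map_nil, List.sum_cons, List.sum_nil, add_zero]
      exact_mod_cast Nat.choose_le_choose 2 (by omega : m₂ ≤ g))
  simp only [List.map_cons, List.map_nil, List.sum_cons, List.sum_nil, add_zero] at hB
  have h5 := two_pow_ge hg41
  have hi : (if t = 3 then (12 : ℚ) else 0) ≤ 12 := by split_ifs <;> norm_num
  nlinarith

/-- **Two disjoint lines, `g ≥ 41`**. -/
theorem table_twoLines_disj_large {t g : ℕ} (ht : t = 1 ∨ t = 2 ∨ t = 3) (hg41 : 41 ≤ g)
    {m₁ m₂ : ℕ} (h2 : 2 ≤ m₂) (hle : m₂ ≤ m₁) (hsum : m₁ + m₂ = g) :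
    0 ≤ A t g + B t g m₁ + (if 3 ≤ m₂ then B t g m₂ else 0) - (if t = 3 then 6 else 0) := by
  rw [A_add_B]
  have hΔ := Δ_single_large ht hg41 (m := m₁) (by omega) (by omega)
  have h5 := two_pow_ge hg41
  have hi : (if t = 3 then (6 : ℚ) else 0) ≤ 6 := by split_ifs <;> norm_num
  have hB : -(6 / 100 * (2 : ℚ) ^ g) ≤ (if 3 ≤ m₂ then B t g m₂ else 0) := by
    split_ifs with h3
    · have hB := sum_B_short_ge ht hg41 [m₂] (by
          intro m hm; simp only [List.mem_singleton] at hm; subst hm; exact ⟨h3, by omega⟩)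
        (by
          simp only [List.map_cons, List.map_nil, List.sum_cons, List.sum_nil, add_zero]
          exact_mod_cast Nat.choose_le_choose 2 (by omega : m₂ ≤ g))
      simpa using hB
    · have : (0 : ℚ) ≤ 2 ^ g := by positivity
      linarith
  nlinarith

/-! ### The rows for every `g ≥ 4` (the kernel table for `4 ≤ g ≤ 40`, the bounds above for `g ≥ 41`) -/

/-- **General plane, no long line, every `g ≥ 4`.** -/
theorem table_general_short_all {t g : ℕ} (ht : t = 1 ∨ t = 2 ∨ t = 3) (hg4 : 4 ≤ g)
    (prof : List ℕ) (hshort : ∀ m ∈ prof, 3 ≤ m ∧ m ≤ (g + 1) / 2)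
    (hsum : (prof.map fun m => (ch m 2 : ℚ)).sum ≤ ch g 2) :
    0 ≤ A t g + (prof.map (B t g)).sum := by
  rcases Nat.lt_or_ge 40 g with h | h
  · exact table_general_short_large ht (by omega) prof hshort hsum
  · exact table_general_short ht hg4 h prof hshort hsum

/-- **General plane with one long line, every `g ≥ 4`.** -/
theorem table_general_long_all {t g : ℕ} (ht : t = 1 ∨ t = 2 ∨ t = 3) (hg4 : 4 ≤ g)
    (m₀ : ℕ) (hm₀ : (g + 1) / 2 < m₀) (hm₀' : m₀ + 3 ≤ g)
    (prof : List ℕ) (hshort : ∀ m ∈ prof, 3 ≤ m ∧ m ≤ (g + 1) / 2)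
    (hsum : (ch m₀ 2 : ℚ) + (prof.map fun m => (ch m 2 : ℚ)).sum ≤ ch g 2) :
    0 ≤ A t g + B t g m₀ + (prof.map (B t g)).sum := by
  rcases Nat.lt_or_ge 40 g with h | h
  · exact table_general_long_large ht (by omega) m₀ hm₀ hm₀' prof hshort hsum
  · exact table_general_long ht hg4 h m₀ hm₀ hm₀' prof hshort hsum

/-- **Line + point, every `g ≥ 4`.** -/
theorem table_linePoint_all {t g : ℕ} (ht : t = 1 ∨ t = 2 ∨ t = 3) (hg4 : 4 ≤ g) :
    0 ≤ A t g + B t g (g - 1) - (if t = 2 then 3 else 0) := by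
  rcases Nat.lt_or_ge 40 g with h | h
  · exact table_linePoint_large ht (by omega)
  · exact table_linePoint ht hg4 h

/-- **Two lines meeting in a point, every `g ≥ 4`.** -/
theorem table_twoLines_meet_all {t g : ℕ} (ht : t = 1 ∨ t = 2 ∨ t = 3) (hg4 : 4 ≤ g)
    {m₁ m₂ : ℕ} (h3 : 3 ≤ m₂) (hle : m₂ ≤ m₁) (hsum : m₁ + m₂ = g + 1) :
    0 ≤ A t g + B t g m₁ + B t g m₂ - (if t = 3 then 12 else 0) := by
  rcases Nat.lt_or_ge 40 g with h | h
  · exact table_twoLines_meet_large ht (by omega) h3 hle hsum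
  · exact table_twoLines_meet ht hg4 h h3 hle hsum

/-- **Two disjoint lines, every `g ≥ 4`.** -/
theorem table_twoLines_disj_all {t g : ℕ} (ht : t = 1 ∨ t = 2 ∨ t = 3) (hg4 : 4 ≤ g)
    {m₁ m₂ : ℕ} (h2 : 2 ≤ m₂) (hle : m₂ ≤ m₁) (hsum : m₁ + m₂ = g) :
    0 ≤ A t g + B t g m₁ + (if 3 ≤ m₂ then B t g m₂ else 0) - (if t = 3 then 6 else 0) := by
  rcases Nat.lt_or_ge 40 g with h | h
  · exact table_twoLines_disj_large ht (by omega) h2 hle hsum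
  · exact table_twoLines_disj ht hg4 h h2 hle hsum

end PercRepro.SixThree.Table
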